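import Mathlib
import HarnessLib

/-!
# Line `lrc-jet` of crux K2 `PoloidalWindowRigidity` — KERNEL REPLAY of the exact jet certificate (prototype)

Cell ns-regularity-ideate, seat ns-poloidal-K2-cert-1 (exact jet-certificate engineer under the K2 lead), 2026-08-27.
Bears on LADDER-NS N0 (route `PoloidalWindowDoor`, crux stmt-NavierStokesRegularity-19708, proposed stub `stub_lrcJet`).

WHAT THIS IS: a kernel-evaluated checker (`decide +kernel`, no `native_decide`, no extra axioms) for identities
`Σ_r y_r · J_r = D · c` between SPARSE RATIONAL ROW VECTORS, where `J_r` is the row of the Jacobian of the weighted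
STEADY jet scheme of `{(v·∇)v + ∇p − Δv = 0, div v = 0, (curl v)₂ = 0}` (free pressure; Taylor coefficients at a
point; pins `v(0)`, `Dv(0)` fixed) at an explicit rational base jet `V`, GENERATED HERE from `V` by the combinatorial
formulas of §1 (no pasted matrix), together with the linear-algebra soundness lemma: such an identity implies
`(∀ r, ⟨J_r, δ⟩ = 0) → ⟨c, δ⟩ = 0` for every coefficient vector `δ : ℕ → ℚ` (a Zariski tangent vector of the jet scheme
at `V`). The data files instantiate `V` = an exact AXISYMMETRIC no-swirl 12-jet and `c` = the functionals
«the vorticity variation of `δ` is not Killing-symmetric to first order» (see the companion STATUS/CERT-DESIGN notes).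

WHAT THIS IS NOT: not a statement about Navier–Stokes regularity; not LRC″; the identification of `rowGen` with the
linearised PDE is DOCUMENTED (§1) and cross-checked against the seat's exact engine, not proved in Lean.
-/

set_option linter.dupNamespace false
set_option autoImplicit false

namespace Summit.NavierStokesRegularity.NavierStokesRegularity.Theorems.PoloidalWindowDoorPoloidalWindowRigidityLrcJetKernel

/-! ### §0 sparse vectors over `ℚ` indexed by `ℕ` -/

/-- A sparse vector: list of (index, coefficient); repeated indices add up. -/
abbrev SpVec : Type := List (ℕ × ℚ)

/-- The linear functional `δ ↦ Σ c·δ(i)` of a sparse vector. -/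
def dot (l : SpVec) (δ : ℕ → ℚ) : ℚ := (l.map fun e => e.2 * δ e.1).sum

/-- `dot` of the empty vector. -/
theorem dot_nil (δ : ℕ → ℚ) : dot [] δ = 0 := rfl

/-- `dot` of a cons. -/
theorem dot_cons (e : ℕ × ℚ) (l : SpVec) (δ : ℕ → ℚ) : dot (e :: l) δ = e.2 * δ e.1 + dot l δ := by
  simp [dot]

/-- `dot` is additive under concatenation. -/
theorem dot_append (a b : SpVec) (δ : ℕ → ℚ) : dot (a ++ b) δ = dot a δ + dot b δ := by
  simp [dot, List.map_append, List.sum_append]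

/-- `dot` is invariant under permutations. -/
theorem dot_perm {a b : SpVec} (h : a.Perm b) (δ : ℕ → ℚ) : dot a δ = dot b δ := by
  unfold dot; exact (h.map _).sum_eq

/-- scale all coefficients. -/
def scale (x : ℚ) (l : SpVec) : SpVec := l.map fun e => (e.1, x * e.2)

/-- `dot` of a scaled vector. -/
theorem dot_scale (x : ℚ) (l : SpVec) (δ : ℕ → ℚ) : dot (scale x l) δ = x * dot l δ := by
  induction l with
  | nil => simp [scale, dot]
  | cons e l ih =>
    simp only [scale, List.map_cons] at *
    rw [dot_cons, dot_cons, ih]; ring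

/-- alternate split (linear, single recursive call). -/
def splitAlt : SpVec → SpVec × SpVec
  | [] => ([], [])
  | x :: xs => match splitAlt xs with
    | (a, b) => (x :: b, a)

/-- unfolding lemma for `splitAlt`. -/
theorem splitAlt_cons (x : ℕ × ℚ) (xs : SpVec) :
    splitAlt (x :: xs) = (x :: (splitAlt xs).2, (splitAlt xs).1) := by
  show (match splitAlt xs with | (a, b) => (x :: b, a)) = _
  rcases splitAlt xs with ⟨a, b⟩
  rfl

/-- the two halves of `splitAlt` are a permutation of the input. -/
theorem splitAlt_perm : ∀ l : SpVec, ((splitAlt l).1 ++ (splitAlt l).2).Perm l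
  | [] => by simp [splitAlt]
  | x :: xs => by
    have ih := splitAlt_perm xs
    rw [splitAlt_cons]
    show ((x :: (splitAlt xs).2) ++ (splitAlt xs).1).Perm (x :: xs)
    rw [List.cons_append]
    exact (List.perm_append_comm.trans ih).cons x

/-- fuelled merge by index (structural in the fuel; any fuel gives a permutation of `a ++ b`). -/
def mergeF : ℕ → SpVec → SpVec → SpVec
  | 0, a, b => a ++ b
  | _ + 1, [], b => b
  | _ + 1, a, [] => a
  | f + 1, x :: a, y :: b => if x.1 ≤ y.1 then x :: mergeF f a (y :: b) else y :: mergeF f (x :: a) b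

/-- `mergeF` returns a permutation of the concatenation (for every fuel). -/
theorem mergeF_perm : ∀ (f : ℕ) (a b : SpVec), (mergeF f a b).Perm (a ++ b)
  | 0, a, b => by simp [mergeF]
  | f + 1, [], b => by simp [mergeF]
  | f + 1, x :: a, [] => by simp [mergeF]
  | f + 1, x :: a, y :: b => by
    simp only [mergeF]
    split
    · exact (mergeF_perm f a (y :: b)).cons x
    · have h := (mergeF_perm f (x :: a) b).cons y
      refine h.trans ?_
      simpa using (List.perm_middle (a := y) (l₁ := x :: a) (l₂ := b)).symm

/-- fuelled merge sort by index (single evaluation of the split). -/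
def msortF : ℕ → SpVec → SpVec
  | 0, l => l
  | f + 1, l =>
    match l with
    | [] => []
    | [x] => [x]
    | x :: y :: rest =>
      match splitAlt (x :: y :: rest) with
      | (l1, l2) => mergeF (rest.length + 2) (msortF f l1) (msortF f l2)

/-- `msortF` returns a permutation of its input (for every fuel). -/
theorem msortF_perm : ∀ (f : ℕ) (l : SpVec), (msortF f l).Perm l
  | 0, l => by simp [msortF]
  | f + 1, [] => by simp [msortF]
  | f + 1, [x] => by simp [msortF]
  | f + 1, x :: y :: rest => by
    have hs := splitAlt_perm (x :: y :: rest)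
    unfold msortF
    exact (mergeF_perm _ _ _).trans (((msortF_perm f _).append (msortF_perm f _)).trans hs)

/-- fuelled combination of ADJACENT equal indices. -/
def combineF : ℕ → SpVec → SpVec
  | 0, l => l
  | _ + 1, [] => []
  | _ + 1, [x] => [x]
  | f + 1, x :: y :: rest => if x.1 = y.1 then combineF f ((x.1, x.2 + y.2) :: rest) else x :: combineF f (y :: rest)

/-- `combineF` preserves `dot`. -/
theorem dot_combineF (δ : ℕ → ℚ) : ∀ (f : ℕ) (l : SpVec), dot (combineF f l) δ = dot l δ
  | 0, l => rfl
  | f + 1, [] => rfl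
  | f + 1, [x] => rfl
  | f + 1, x :: y :: rest => by
    simp only [combineF]
    split
    · rename_i h
      rw [dot_combineF δ f, dot_cons, dot_cons, dot_cons, h]; ring
    · rw [dot_cons, dot_cons, dot_combineF δ f]

/-- drop zero coefficients. -/
def dropZeros (l : SpVec) : SpVec := l.filter fun e => e.2 ≠ 0

/-- `dropZeros` preserves `dot`. -/
theorem dot_dropZeros (l : SpVec) (δ : ℕ → ℚ) : dot (dropZeros l) δ = dot l δ := by
  induction l with
  | nil => rfl
  | cons e l ih =>
    unfold dropZeros at *
    rw [List.filter_cons]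
    by_cases h : e.2 = 0
    · have hd : decide (e.2 ≠ 0) = false := by simp [h]
      rw [hd]
      simp only [Bool.false_eq_true, ↓reduceIte]
      rw [dot_cons, h, zero_mul, zero_add]; exact ih
    · have hd : decide (e.2 ≠ 0) = true := by simp [h]
      rw [hd]
      simp only [↓reduceIte]
      rw [dot_cons, dot_cons, ih]

/-- normal form: sorted by index, adjacent duplicates combined, zeros dropped (fuel = length). -/
def normalizeSp (l : SpVec) : SpVec := dropZeros (combineF l.length (msortF l.length l))

/-- `normalizeSp` preserves the linear functional `dot`. -/
theorem dot_normalizeSp (l : SpVec) (δ : ℕ → ℚ) : dot (normalizeSp l) δ = dot l δ := by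
  unfold normalizeSp
  rw [dot_dropZeros, dot_combineF, dot_perm (msortF_perm _ _)]

/-! ### §1 the steady poloidal jet scheme: monomials, column indexing, row generator

Coordinates `x₀,x₁` horizontal, `x₂` vertical (the tree's poloidal convention `(curl v)₂ = 0`). Monomials of
degree `d` are triples `(a₀,a₁,a₂)`, `a₀+a₁+a₂ = d`, enumerated `a₀ = 0..d`, `a₁ = 0..d−a₀` (position `posOf`).
Unknown (tangent) coordinates: for levels `n = 2..N`: `δv_i` of degree `n` (`i = 0,1,2`, block size `P n`), then
`δp` of degree `n−1` (`P (n−1)`); global index `colV i n m`, `colP n' m`.  Equations (rows) at level `n`: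
`NS_i` = degree-`(n−2)` Taylor coefficients of `(V·∇)δv_i + (δv·∇)V_i + ∂_i δp − Δ δv_i` (linearisation at `V` of
`(v·∇)v_i + ∂_i p − Δ v_i`, viscosity 1), `DIV` = degree-`(n−1)` coefficients of `div δv`, `POL` = degree-`(n−1)`
coefficients of `∂₀δv₁ − ∂₁δv₀`.  `V : JetTerms` holds the base jet as a term list. -/

/-- number of monomials of degree `d` in three variables. -/
def P (d : ℕ) : ℕ := (d + 1) * (d + 2) / 2

/-- position of the monomial `(a₀,a₁,a₂)` within its degree. -/
def posOf (m : ℕ × ℕ × ℕ) : ℕ :=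
  let d := m.1 + m.2.1 + m.2.2
  m.1 * (d + 1) - (m.1 * (m.1 - 1)) / 2 + m.2.1

/-- the `pos`-th monomial of degree `d` (inverse of `posOf`), by enumeration. -/
def monos (d : ℕ) : List (ℕ × ℕ × ℕ) :=
  (List.range (d + 1)).flatMap fun a0 => (List.range (d - a0 + 1)).map fun a1 => (a0, a1, d - a0 - a1)

/-- the `pos`-th monomial of degree `d`. -/
def monoAt (d pos : ℕ) : ℕ × ℕ × ℕ := (monos d).getD pos (0, 0, 0)

/-- degree. -/
def deg (m : ℕ × ℕ × ℕ) : ℕ := m.1 + m.2.1 + m.2.2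

/-- offset of level `n` (levels start at 2). -/
def base : ℕ → ℕ
  | 0 => 0
  | 1 => 0
  | 2 => 0
  | n + 1 => base n + 3 * P n + P (n - 1)

/-- global index of the coefficient of monomial `m` (degree `n`) of `δv_i`. -/
def colV (i n : ℕ) (m : ℕ × ℕ × ℕ) : ℕ := base n + i * P n + posOf m
/-- global index of the coefficient of monomial `m` (degree `n'`) of `δp` (attached to level `n'+1`). -/
def colP (n' : ℕ) (m : ℕ × ℕ × ℕ) : ℕ := base (n' + 1) + 3 * P (n' + 1) + posOf m

/-- component access / unit shifts of exponent triples. -/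
def mget (m : ℕ × ℕ × ℕ) (k : ℕ) : ℕ := if k = 0 then m.1 else if k = 1 then m.2.1 else m.2.2
/-- add `c` to the `k`-th exponent. -/
def madd (m : ℕ × ℕ × ℕ) (k c : ℕ) : ℕ × ℕ × ℕ :=
  if k = 0 then (m.1 + c, m.2.1, m.2.2) else if k = 1 then (m.1, m.2.1 + c, m.2.2) else (m.1, m.2.1, m.2.2 + c)
/-- componentwise difference (only used when `m' ≤ m`). -/
def msub (m m' : ℕ × ℕ × ℕ) : ℕ × ℕ × ℕ := (m.1 - m'.1, m.2.1 - m'.2.1, m.2.2 - m'.2.2)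

/-- `m' ≤ m` componentwise. -/
def mle (m' m : ℕ × ℕ × ℕ) : Bool := decide (m'.1 ≤ m.1) && decide (m'.2.1 ≤ m.2.1) && decide (m'.2.2 ≤ m.2.2)

/-- The base jet as a TERM LIST: `(j, (a₀,a₁,a₂), c)` = the coefficient `c ≠ 0` of `x^a` in the component `V_j`
(a polynomial vector field of degree `≤ N`, i.e. the Taylor jet of the base flow). -/
abbrev JetTerms : Type := List (ℕ × (ℕ × ℕ × ℕ) × ℚ)

/-- A row descriptor: `(n, kind, i, pos)` with `kind = 0` (`NS_i`, monomial of degree `n−2`), `1` (`DIV`, degree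
`n−1`), `2` (`POL`, degree `n−1`). -/
abbrev RowD : Type := ℕ × ℕ × ℕ × ℕ

/-- **The row generator** (§1): the sparse row `J_r` of the Jacobian of the steady poloidal jet scheme at the base jet
`V` (levels `2..N` are unknowns; the pinned levels `0,1` have no columns). -/
def rowGen (V : JetTerms) (r : RowD) : SpVec :=
  let n := r.1; let kind := r.2.1; let i := r.2.2.1; let pos := r.2.2.2
  if kind = 0 then
    let m := monoAt (n - 2) pos
    -- −Δ δv_i
    let lap := (List.range 3).map fun k =>
      (colV i n (madd m k 2), -((((mget m k + 2) * (mget m k + 1) : ℕ) : ℤ) : ℚ))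
    -- + ∂_i δp
    let pres := [(colP (n - 1) (madd m i 1), (((mget m i + 1 : ℕ) : ℤ) : ℚ))]
    -- + (V_j ∂_j δv_i): for each term (j, m', c) of V with m' ≤ m and level b = n−1−deg m' ≥ 2:
    --   column δv_i, level b, monomial (m − m') + e_j; coefficient c · (m_j − m'_j + 1)
    let bilA := V.filterMap fun t =>
      let j := t.1; let m' := t.2.1; let c := t.2.2
      if mle m' m && decide (deg m' + 3 ≤ n) then
        some (colV i (n - 1 - deg m') (madd (msub m m') j 1), c * (((mget m j - mget m' j + 1 : ℕ) : ℤ) : ℚ))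
      else none
    -- + (δv_j ∂_j V_i): for each term (i, μ, c) of V (same component as the row) and each j with μ_j ≥ 1 and
    --   μ − e_j ≤ m: column δv_j, monomial m' = m − μ + e_j of degree ≥ 2; coefficient μ_j · c
    let bilB := V.flatMap fun t =>
      if t.1 = i then
        (List.range 3).filterMap fun j =>
          let μ := t.2.1; let c := t.2.2
          if decide (1 ≤ mget μ j) then
            let μ' := msub μ (madd (0, 0, 0) j 1)
            if mle μ' m then
              let m' := msub (madd m j 1) μ
              if decide (2 ≤ deg m') then some (colV j (deg m') m', (((mget μ j : ℕ) : ℤ) : ℚ) * c) else none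
            else none
          else none
      else []
    lap ++ pres ++ bilA ++ bilB
  else if kind = 1 then
    let m := monoAt (n - 1) pos
    (List.range 3).map fun k => (colV k n (madd m k 1), (((mget m k + 1 : ℕ) : ℤ) : ℚ))
  else
    let m := monoAt (n - 1) pos
    [(colV 1 n (madd m 0 1), (((mget m 0 + 1 : ℕ) : ℤ) : ℚ)), (colV 0 n (madd m 1 1), -(((mget m 1 + 1 : ℕ) : ℤ) : ℚ))]

/-! ### §2 the certificate checker and its soundness -/

/-- `Σ_r y_r · J_r` as one unnormalised sparse vector. -/
def comboRows (V : JetTerms) (Y : List (RowD × ℚ)) : SpVec :=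
  Y.flatMap fun e => scale e.2 (rowGen V e.1)

/-- `dot` of the weighted row combination is the weighted sum of the rows' `dot`s. -/
theorem dot_comboRows (V : JetTerms) (δ : ℕ → ℚ) :
    ∀ Y : List (RowD × ℚ), dot (comboRows V Y) δ = (Y.map fun e => e.2 * dot (rowGen V e.1) δ).sum
  | [] => rfl
  | e :: Y => by
    have ih := dot_comboRows V δ Y
    unfold comboRows at ih ⊢
    rw [List.flatMap_cons, dot_append, dot_scale, ih]
    simp only [List.map_cons, List.sum_cons]

/-- The certificate check: `normalize (Σ_r y_r J_r) = normalize (D · c)`. -/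
def certCheck (V : JetTerms) (Y : List (RowD × ℚ)) (D : ℚ) (c : SpVec) : Bool :=
  normalizeSp (comboRows V Y) == normalizeSp (scale D c)

/-- **Soundness of the certificate.** If the check passes with `D ≠ 0`, every `δ` annihilated by the generated
rows `J_r` used in `Y` is annihilated by `c`. -/
theorem dot_eq_zero_of_certCheck (V : JetTerms) (Y : List (RowD × ℚ)) (D : ℚ) (c : SpVec)
    (hD : D ≠ 0) (hcheck : certCheck V Y D c = true) (δ : ℕ → ℚ)
    (hJ : ∀ e ∈ Y, dot (rowGen V e.1) δ = 0) : dot c δ = 0 := by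
  have h : normalizeSp (comboRows V Y) = normalizeSp (scale D c) := by
    simpa [certCheck] using hcheck
  have h1 : dot (comboRows V Y) δ = D * dot c δ := by
    rw [← dot_normalizeSp, h, dot_normalizeSp, dot_scale]
  have h2 : dot (comboRows V Y) δ = 0 := by
    rw [dot_comboRows]
    apply List.sum_eq_zero
    intro x hx
    rw [List.mem_map] at hx
    obtain ⟨e, he, rfl⟩ := hx
    rw [hJ e he, mul_zero]
  have : D * dot c δ = 0 := by rw [← h1, h2]
  rcases mul_eq_zero.mp this with h | h
  · exact absurd h hD
  · exact h


/-! ### §2b compact data encodings (fast to elaborate: plain `ℕ`/`ℤ` literals, assembled by the kernel) -/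

/-- decode a global row index (levels `2..N` in order; within level `n`: `NS₀,NS₁,NS₂` blocks of size `P (n−2)`,
then `DIV`, `POL` of size `P (n−1)`) into a row descriptor. -/
def rowOfIndexAux : ℕ → ℕ → ℕ → RowD
  | 0, _, _ => (0, 0, 0, 0)
  | fuel + 1, n, r =>
    let R := P (n - 2); let Q := P (n - 1)
    if r < 3 * R then (n, 0, r / R, r % R)
    else if r < 3 * R + Q then (n, 1, 0, r - 3 * R)
    else if r < 3 * R + 2 * Q then (n, 2, 0, r - 3 * R - Q)
    else rowOfIndexAux fuel (n + 1) (r - 3 * R - 2 * Q)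

/-- decode a global row index (see `rowOfIndexAux`). -/
def rowOfIndex (N r : ℕ) : RowD := rowOfIndexAux (N + 1) 2 r

/-- weighted rows from parallel lists of row indices and integer weights. -/
def mkY (N : ℕ) (rows : List ℕ) (w : List ℤ) : List (RowD × ℚ) :=
  (List.zip rows w).map fun e => (rowOfIndex N e.1, (e.2 : ℚ))

/-- sparse vector from parallel lists of indices and integer values. -/
def mkC (cols : List ℕ) (vals : List ℤ) : SpVec := (List.zip cols vals).map fun e => (e.1, (e.2 : ℚ))

/-- base jet (term list) from parallel lists: components, exponents, numerators, denominators. -/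
def mkV (js : List ℕ) (ex : List (ℕ × ℕ × ℕ)) (num : List ℤ) (den : List ℤ) : JetTerms :=
  (List.zip js (List.zip ex (List.zip num den))).map fun e => (e.1, e.2.1, Rat.divInt e.2.2.1 e.2.2.2)


/-- From «all generated rows with index `< B` annihilate `δ`» to the row hypothesis of `dot_eq_zero_of_certCheck` for
weighted rows built by `mkY` from indices that are all `< B`. -/
theorem mkY_rows_annihilate (N : ℕ) (V : JetTerms) (rows : List ℕ) (w : List ℤ) (B : ℕ)
    (hB : rows.all (fun r => decide (r < B)) = true) (δ : ℕ → ℚ)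
    (hJ : ∀ r, r < B → dot (rowGen V (rowOfIndex N r)) δ = 0) :
    ∀ e ∈ mkY N rows w, dot (rowGen V e.1) δ = 0 := by
  intro e he
  unfold mkY at he
  rw [List.mem_map] at he
  obtain ⟨p, hp, rfl⟩ := he
  have hmem : p.1 ∈ rows := (List.of_mem_zip hp).1
  have hlt : p.1 < B := by
    have := List.all_eq_true.mp hB _ hmem
    exact of_decide_eq_true this
  exact hJ _ hlt

/-- **Certificate ⇒ annihilation** (the form used by the data files): if the kernel check passes for
`(rows, w, D, c)` with `D ≠ 0` and all row indices `< B`, then every `δ` annihilated by the generated rows of index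
`< B` is annihilated by `c`. -/
theorem dot_eq_zero_of_certCheck_mkY (N : ℕ) (V : JetTerms) (rows : List ℕ) (w : List ℤ) (D : ℚ) (c : SpVec)
    (B : ℕ) (hB : rows.all (fun r => decide (r < B)) = true) (hD : D ≠ 0)
    (hcheck : certCheck V (mkY N rows w) D c = true) (δ : ℕ → ℚ)
    (hJ : ∀ r, r < B → dot (rowGen V (rowOfIndex N r)) δ = 0) : dot c δ = 0 :=
  dot_eq_zero_of_certCheck V (mkY N rows w) D c hD hcheck δ (mkY_rows_annihilate N V rows w B hB δ hJ)

end Summit.NavierStokesRegularity.NavierStokesRegularity.Theorems.PoloidalWindowDoorPoloidalWindowRigidityLrcJetKernel
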